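import Summits.MatrixMultiplication.OmegaCensus.STPPAlignedKneserFilter

/-!
# ω-census (abelian STPP census): filter N18 — the DOUBLE-KNESER ALIGNED LAW (kernel)

HONEST FRAMING (pub-omega census; verbatim): lottery ticket; floor = certified bounds/negative ranges.
Census BOOKKEEPING / STRUCTURE (seat pub-omega-stpp-1 gen 27, 2026-08-27), family (b2).  A necessary condition on STPP families in finite
abelian groups — a tool for EXCLUDING candidate block patterns by theorem; nothing here is progress on `ω`.

## Statement

Setting of `STPPAlignedKneserFilter.lean` (N17): STPP family with non-empty sets in a finite abelian `H`, `|H| = n`, `N ≥ 2`; block `i`, `vol = aᵢbᵢcᵢ`,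
`Y° = ⋃_{k≠i}(C_k − B_k)`, `Z° = ⋃_{k≠i}(C_k − A_k)`, `W = Cᵢ − Aᵢ − Bᵢ`, `kLB = STPPKneser.kneserLB`.

The one inclusion behind N16/N17 is `Xᵢ + Y ⊆ H ∖ Z°` (`Y = ⋃_k Y_k`), read as `Bᵢ + (−Aᵢ + Y)` with `−Aᵢ + Y = W ⊔ (Y° − Aᵢ)` — a DISJOINT union
(pattern `(i,k,i)`), `|W| = vol` (TPP).  N17 applied Kneser once (union over `e_A` OR over `e_B`); N18 applies it TWICE (union over both):

  `|Y° − Aᵢ| ≥ kLB(aᵢ, |Y°|, d′)` for some `d′ ∣ n`,   `|Bᵢ + (W ⊔ (Y° − Aᵢ))| ≥ kLB(bᵢ, vol + |Y° − Aᵢ|, d)` for some `d ∣ n`,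

hence (`exists_dvd_dvd_alignedKneser_AB`) **for some divisors `d, d′` of `n`:  `|Z°| + kLB(bᵢ, vol + kLB(aᵢ, |Y°|, d′), d) ≤ n`**, which implies both sides of
N17 (`kLB(s,t,·) ≥ t`).  Decidable predicate `N18Dead` (six role readings, two bounded divisor quantifiers) with `not_isSTPP_of_n18Dead{1,,'}`.
In `ℤ_p` (`d = d′ = 1`): `vol + Σ_{k≠i}(a_k + b_k)c_k + aᵢ + bᵢ − 2 ≤ p`.

Measured bite (HOME `pub-omega-stpp-1-g27/fronts/`, python reader `n18_filter.py`): ℤ₅₇ front of record 2 128: alive under N7–N12 + N16 + N17 = 20 → with N18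
**18**; ℤ₅₈ front (GO #52): 84 → **35**; ℤ₅₉: 124 → **31**; the 17 abelian logs (orders 48–57): UNSAT 1 733/5 588, cores 945/4 025; abelian `≤ 16` census
57/201 INFEASIBLE items; every N17 kill is an N18 kill (checked on all three lists).  SOUNDNESS of the arithmetic: 0/568 FEASIBLE, 0/1 984 SAT-witnessed patterns.

References: M. Kneser, Math. Z. 58 (1953) (tree: `Literature.Combinatorics.Additive.add_kneser`); H. Cohn, R. Kleinberg, B. Szegedy, C. Umans, FOCS 2005
(arXiv:math/0511460), Def. 5.1.
-/

open Finset
open scoped Pointwise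

namespace Summit.MatrixMultiplication.OmegaCensus.CubeNB

open Literature.Computability.AlgebraicComplexity
open Summit.MatrixMultiplication.OmegaCensus.STPPKneser

variable {H : Type*} [AddCommGroup H] [DecidableEq H] [Fintype H] {N : ℕ} {A B C : Fin N → Finset H}

/-! ## §1 The double-Kneser law -/

section Law

/-- `kneserLB` is monotone in its second argument. [folklore] -/
theorem kneserLB_mono_right (s : ℕ) {t t' : ℕ} (d : ℕ) (h : t ≤ t') : kneserLB s t d ≤ kneserLB s t' d := by
  unfold kneserLB
  have h1 : (t + d - 1) / d ≤ (t' + d - 1) / d := Nat.div_le_div_right (by omega)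
  exact Nat.mul_le_mul_right d (Nat.sub_le_sub_right (Nat.add_le_add_left h1 _) 1)

omit [Fintype H] in
/-- `W = {c − a − b}` (written with a leading `0 +`) is disjoint from the whole sumset `(−Aᵢ) + Y°`: pattern `(i,k,i)` for each `a ∈ Aᵢ`
(`disjoint_image_blockSum_translate_DU_full` with `e_B = 0`). [cite: CohnKleinbergSzegedyUmans2005, Def. 5.1] -/
theorem disjoint_W_negA_add_DU (hS : IsSTPP A B C) (i : Fin N) :
    Disjoint (((A i) ×ˢ ((B i) ×ˢ (C i))).image fun q : H × H × H => (0 : H) + q.2.2 - q.1 - q.2.1)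
      ((A i).image (fun a => (0 : H) - a) + DU B C (univ.erase i)) := by
  rw [Finset.disjoint_left]
  intro w hw hw'
  obtain ⟨x, hx, y, hy, rfl⟩ := Finset.mem_add.1 hw'
  obtain ⟨a, ha, rfl⟩ := Finset.mem_image.1 hx
  have hmem : (0 : H) - a + y ∈ (DU B C (univ.erase i)).image fun y => (0 : H) - a + y := Finset.mem_image.2 ⟨y, hy, rfl⟩
  exact Finset.disjoint_left.1 (disjoint_image_blockSum_translate_DU_full hS i (eB := 0) ha) hw hmem

/-- **The inclusion `Xᵢ + Y ⊆ H ∖ Z°` in the form `Bᵢ + (W ∪ ((−Aᵢ) + Y°)) ⊆ H ∖ Z°`**: `b + (c − a − b′) ∈ b + W` misses `Z°` (pattern `(i,i,k)`), and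
`b + (−a + y) = (b − a) + y` misses `Z°` (alignment with `x₀ = b − a`). [cite: CohnKleinbergSzegedyUmans2005, Def. 5.1] -/
theorem B_add_W_union_negA_add_subset (hS : IsSTPP A B C) (i : Fin N) :
    B i + ((((A i) ×ˢ ((B i) ×ˢ (C i))).image fun q : H × H × H => (0 : H) + q.2.2 - q.1 - q.2.1) ∪
        ((A i).image (fun a => (0 : H) - a) + DU B C (univ.erase i))) ⊆ univ \ DU A C (univ.erase i) := by
  intro w hw
  rw [Finset.mem_sdiff]
  refine ⟨Finset.mem_univ _, fun hz => ?_⟩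
  obtain ⟨b, hb, v, hv, rfl⟩ := Finset.mem_add.1 hw
  rcases Finset.mem_union.1 hv with hvW | hvY
  · obtain ⟨⟨a, b', c⟩, hq, rfl⟩ := Finset.mem_image.1 hvW
    have hmem : b + ((0 : H) + c - a - b') ∈
        ((A i) ×ˢ ((B i) ×ˢ (C i))).image fun q : H × H × H => b + q.2.2 - q.1 - q.2.1 := by
      refine Finset.mem_image.2 ⟨⟨a, b', c⟩, hq, ?_⟩
      show b + c - a - b' = b + ((0 : H) + c - a - b')
      abel
    exact Finset.disjoint_left.1 (disjoint_image_blockSum_DU hS i hb) hmem hz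
  · obtain ⟨x, hx, y, hy, rfl⟩ := Finset.mem_add.1 hvY
    obtain ⟨a, ha, rfl⟩ := Finset.mem_image.1 hx
    have hmem : b + ((0 : H) - a + y) ∈ (DU B C (univ.erase i)).image fun y => b - a + y := by
      refine Finset.mem_image.2 ⟨y, hy, ?_⟩
      show b - a + y = b + ((0 : H) - a + y)
      abel
    exact Finset.disjoint_left.1 (disjoint_translate_DU_BC_DU_AC hS i ha hb) hmem hz

/-- **N18 (double-Kneser aligned law), `C`-reading.**  For an STPP family with non-empty sets, a block `i` and another block `j ≠ i`: for SOME divisors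
`d, d′` of `|H|`,  `Σ_{k≠i} |A_k||C_k| + kLB(|Bᵢ|, |Aᵢ||Bᵢ||Cᵢ| + kLB(|Aᵢ|, Σ_{k≠i} |B_k||C_k|, d′), d) ≤ |H|`.
[cite: Kneser1953] [cite: CohnKleinbergSzegedyUmans2005, Def. 5.1] -/
theorem exists_dvd_dvd_alignedKneser_AB (hS : IsSTPP A B C) (hA : ∀ i, (A i).Nonempty) (hB : ∀ i, (B i).Nonempty)
    (hC : ∀ i, (C i).Nonempty) (i : Fin N) (hI : (univ.erase i : Finset (Fin N)).Nonempty) :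
    ∃ d d' : ℕ, (0 < d ∧ d ∣ Fintype.card H) ∧ (0 < d' ∧ d' ∣ Fintype.card H) ∧
      ∑ k ∈ univ.erase i, #(A k) * #(C k) +
        kneserLB #(B i) (#(A i) * #(B i) * #(C i) + kneserLB #(A i) (∑ k ∈ univ.erase i, #(B k) * #(C k)) d') d ≤
          Fintype.card H := by
  set W := ((A i) ×ˢ ((B i) ×ˢ (C i))).image fun q : H × H × H => (0 : H) + q.2.2 - q.1 - q.2.1 with hW
  set S := (A i).image (fun a => (0 : H) - a) with hSdef
  set Yo := DU B C (univ.erase i) with hYo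
  set Zo := DU A C (univ.erase i) with hZo
  have hWcard : #W = #(A i) * #(B i) * #(C i) := card_image_blockSum hS i 0
  have hScard : #S = #(A i) := Finset.card_image_of_injective _ (sub_right_injective)
  have hYcard : #Yo = ∑ k ∈ univ.erase i, #(B k) * #(C k) := card_DU_BC hS hA _
  have hZcard : #Zo = ∑ k ∈ univ.erase i, #(A k) * #(C k) := card_DU_AC hS hB _
  -- first Kneser: |(−Aᵢ) + Y°| ≥ kLB(aᵢ, |Y°|, d')
  obtain ⟨d', hd', hdvd', hk'⟩ := exists_dvd_kneserLB_le_card_add S Yo ((hA i).image _) (DU_nonempty hI hB hC)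
  -- the disjoint union V = W ⊔ (S + Y°)
  have hWV : Disjoint W (S + Yo) := disjoint_W_negA_add_DU hS i
  have hVcard : #(W ∪ (S + Yo)) = #W + #(S + Yo) := Finset.card_union_of_disjoint hWV
  have hVne : (W ∪ (S + Yo)).Nonempty :=
    (((hA i).image _).add (DU_nonempty hI hB hC)).mono Finset.subset_union_right
  -- second Kneser: |Bᵢ + V| ≥ kLB(bᵢ, |V|, d)
  obtain ⟨d, hd, hdvd, hk⟩ := exists_dvd_kneserLB_le_card_add (B i) (W ∪ (S + Yo)) (hB i) hVne
  have hU : #(univ \ Zo) = Fintype.card H - #Zo := by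
    rw [Finset.card_sdiff_of_subset (Finset.subset_univ _), Finset.card_univ]
  have hle : #Zo ≤ Fintype.card H := Finset.card_le_univ _
  have hsub0 := Finset.card_le_card (B_add_W_union_negA_add_subset hS i)
  rw [hU] at hsub0
  have hsub : #(B i + (W ∪ (S + Yo))) ≤ Fintype.card H - #Zo := hsub0
  -- monotonicity: replace |V| by its lower bound vol + kLB(aᵢ, |Y°|, d')
  have hmono : kneserLB #(B i) (#(A i) * #(B i) * #(C i) + kneserLB #(A i) (∑ k ∈ univ.erase i, #(B k) * #(C k)) d') d ≤
      kneserLB #(B i) #(W ∪ (S + Yo)) d := by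
    apply kneserLB_mono_right
    rw [hVcard, hWcard, ← hScard, ← hYcard]
    omega
  refine ⟨d, d', ⟨hd, hdvd⟩, ⟨hd', hdvd'⟩, ?_⟩
  rw [hZcard] at hsub hle
  omega

end Law

/-! ## §2 The decidable card-vector predicate (six readings) and the filter theorem -/

section Filter

/-- **Filter N18, one reading** on the card vectors: some block `i` (with another block `j ≠ i`) has
`Σ_{k≠i} a_k c_k + kLB(bᵢ, aᵢbᵢcᵢ + kLB(aᵢ, Σ_{k≠i} b_k c_k, d′), d) > n` for ALL divisors `d, d′` of `n` (quantifiers over `Nat.divisors n`, decidable).  Same verdicts as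
HOME `pub-omega-stpp-1-g27/fronts/n18_filter.py` (`dead_C`). [folklore] -/
def N18Dead1 (n N : ℕ) (a b c : Fin N → ℕ) : Bool :=
  decide (∃ i j : Fin N, j ≠ i ∧
    ∀ d ∈ Nat.divisors n, ∀ d' ∈ Nat.divisors n,
      n - ∑ k ∈ univ.erase i, a k * c k <
        kneserLB (b i) (a i * b i * c i + kneserLB (a i) (∑ k ∈ univ.erase i, b k * c k) d') d)

/-- **Filter N18** on the card vectors: `N18Dead1` for one of the six role permutations `(a,b,c)`, `(b,c,a)`, `(c,a,b)`, `(c,b,a)`, `(b,a,c)`, `(a,c,b)`. [folklore] -/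
def N18Dead (n N : ℕ) (a b c : Fin N → ℕ) : Bool :=
  N18Dead1 n N a b c || N18Dead1 n N b c a || N18Dead1 n N c a b ||
    N18Dead1 n N c b a || N18Dead1 n N b a c || N18Dead1 n N a c b

/-- **Filter N18, one reading (kernel).** [cite: Kneser1953] [cite: CohnKleinbergSzegedyUmans2005, Def. 5.1] -/
theorem not_isSTPP_of_n18Dead1 (hS : IsSTPP A B C) (hA : ∀ i, (A i).Nonempty) (hB : ∀ i, (B i).Nonempty)
    (hC : ∀ i, (C i).Nonempty) {n : ℕ} (hn : Fintype.card H = n) {a b c : Fin N → ℕ} (ha : ∀ i, #(A i) = a i)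
    (hb : ∀ i, #(B i) = b i) (hc : ∀ i, #(C i) = c i) (hdead : N18Dead1 n N a b c = true) : False := by
  obtain ⟨i, j, hji, h⟩ := of_decide_eq_true hdead
  have hI : (univ.erase i : Finset (Fin N)).Nonempty := ⟨j, Finset.mem_erase.2 ⟨hji, Finset.mem_univ _⟩⟩
  have hn0 : n ≠ 0 := by rw [← hn]; exact Fintype.card_ne_zero
  have eAC : ∑ k ∈ univ.erase i, #(A k) * #(C k) = ∑ k ∈ univ.erase i, a k * c k :=
    Finset.sum_congr rfl fun k _ => by rw [ha, hc]
  have eBC : ∑ k ∈ univ.erase i, #(B k) * #(C k) = ∑ k ∈ univ.erase i, b k * c k :=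
    Finset.sum_congr rfl fun k _ => by rw [hb, hc]
  obtain ⟨d, d', ⟨-, hdvd⟩, ⟨-, hdvd'⟩, hle⟩ := exists_dvd_dvd_alignedKneser_AB hS hA hB hC i hI
  rw [hn] at hdvd hdvd' hle
  rw [ha, hb, hc, eAC, eBC] at hle
  have := h d (Nat.mem_divisors.2 ⟨hdvd, hn0⟩) d' (Nat.mem_divisors.2 ⟨hdvd', hn0⟩)
  omega

/-- **Filter N18 (kernel): an STPP family with non-empty sets in a finite abelian group `H` whose pattern `(|Aᵢ|,|Bᵢ|,|Cᵢ|)ᵢ` is `N18Dead |H|` does not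
exist** — six readings via `stpp_rotate` and `isSTPP_neg_reverse`. [cite: Kneser1953] [cite: CohnKleinbergSzegedyUmans2005, Def. 5.1] -/
theorem not_isSTPP_of_n18Dead (hS : IsSTPP A B C) (hA : ∀ i, (A i).Nonempty) (hB : ∀ i, (B i).Nonempty)
    (hC : ∀ i, (C i).Nonempty) {n : ℕ} (hn : Fintype.card H = n) {a b c : Fin N → ℕ} (ha : ∀ i, #(A i) = a i)
    (hb : ∀ i, #(B i) = b i) (hc : ∀ i, #(C i) = c i) (hdead : N18Dead n N a b c = true) : False := by
  simp only [N18Dead, Bool.or_eq_true] at hdead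
  have hR := isSTPP_neg_reverse hS
  have hnA : ∀ i, #((fun j => -(A j)) i) = a i := fun i => by rw [card_neg_family, ha]
  have hnB : ∀ i, #((fun j => -(B j)) i) = b i := fun i => by rw [card_neg_family, hb]
  have hnC : ∀ i, #((fun j => -(C j)) i) = c i := fun i => by rw [card_neg_family, hc]
  rcases hdead with ((((h | h) | h) | h) | h) | h
  · exact not_isSTPP_of_n18Dead1 hS hA hB hC hn ha hb hc h
  · exact not_isSTPP_of_n18Dead1 (stpp_rotate hS) hB hC hA hn hb hc ha h
  · exact not_isSTPP_of_n18Dead1 (stpp_rotate (stpp_rotate hS)) hC hA hB hn hc ha hb h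
  · exact not_isSTPP_of_n18Dead1 hR (nonempty_neg_family hC) (nonempty_neg_family hB) (nonempty_neg_family hA)
      hn hnC hnB hnA h
  · exact not_isSTPP_of_n18Dead1 (stpp_rotate hR) (nonempty_neg_family hB) (nonempty_neg_family hA)
      (nonempty_neg_family hC) hn hnB hnA hnC h
  · exact not_isSTPP_of_n18Dead1 (stpp_rotate (stpp_rotate hR)) (nonempty_neg_family hA) (nonempty_neg_family hC)
      (nonempty_neg_family hB) hn hnA hnC hnB h

/-- Card-vector form with literal vectors: non-emptiness from positivity of the entries. [cite: Kneser1953] [cite: CohnKleinbergSzegedyUmans2005, Def. 5.1] -/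
theorem not_isSTPP_of_n18Dead' (hS : IsSTPP A B C) {n : ℕ} (hn : Fintype.card H = n) (a b c : Fin N → ℕ)
    (ha : ∀ i, #(A i) = a i) (hb : ∀ i, #(B i) = b i) (hc : ∀ i, #(C i) = c i)
    (hpos : ∀ i, 0 < a i ∧ 0 < b i ∧ 0 < c i) (hdead : N18Dead n N a b c = true) : False :=
  not_isSTPP_of_n18Dead hS (fun i => card_pos.1 ((ha i).symm ▸ (hpos i).1))
    (fun i => card_pos.1 ((hb i).symm ▸ (hpos i).2.1)) (fun i => card_pos.1 ((hc i).symm ▸ (hpos i).2.2))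
    hn ha hb hc hdead

end Filter

/-! ## §3 Example -/

section Examples

/-- A ℤ₅₉ front leaf alive under N7–N12 and N16–N17, `{(2,3,6), (3,3,3)}` (`Σ abc = 36 + 27 = 63 > 59`), carries no STPP family in ANY abelian group of
order `59`: identity reading at the `(3,3,3)` block (`vol = 27`, `|Y°| = 18`, `|Z°| = 12`): N16 gives `57 ≤ 59`, N17's sides give `59 ≤ 59` and `59 ≤ 59`, but
`|Z°| + kLB(3, 27 + kLB(3, 18, 1), 1) = 12 + 49 = 61 > 59` (and `d` or `d′ = 59` only increases the bound). [cite: Kneser1953] [cite: CohnKleinbergSzegedyUmans2005, Def. 5.1] -/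
theorem no_isSTPP_Z59_236_333 (hH : Fintype.card H = 59) (A B C : Fin 2 → Finset H) (hS : IsSTPP A B C)
    (hA : ∀ i, #(A i) = ![2, 3] i) (hB : ∀ i, #(B i) = ![3, 3] i) (hC : ∀ i, #(C i) = ![6, 3] i) : False :=
  not_isSTPP_of_n18Dead' hS hH _ _ _ hA hB hC (by decide) (by decide)

end Examples

end Summit.MatrixMultiplication.OmegaCensus.CubeNB
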